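import Summits.MatrixMultiplication.OmegaCensus.DominoStructureChar
import HarnessLib

/-!
# Towards the structure theorem for ALL cube law shapes (c,c | d,d | e,e) in generalized dihedral groups — character core

ω-census `pub-omega`, family (b3), seat pub-omega-group gen 6.  Framing: lottery ticket; floor = certified bounds/negative
ranges.  VALUE: theorems about the group-theoretic method (TPP triples in dihedral-like groups); NOT progress on ω.

For a law-attaining TPP triple with cube coset parts in `Dih(A)` (`c₀ = 0`) the eight vertex near-tilings (vertices `000`/`111`
of `(S,T,U)` and of its three right translates by `τ0`, whose parts are `(−X₁, −X₀)`) give eight unit equations `E1 … E8` in the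
six character sums `σᵢ, τⱼ, υₖ` at every non-trivial `ψ` (`pᵢ = ψ` of the missed points).  This file provides the two
re-usable algebraic steps of the general structure theorem (paper proof: cell file `THEORY-structure-1de.md` §5):

* `unit_pair_dichotomy` — the `2 × 2` mechanism of `DominoStructureChar` with a FREE triple `(F, H, K)` (conjugates
  `(G, Hc, Kc)`): the pair acted on is homometric at `ψ`, or `F·G = H·Hc = K·Kc` (`|F| = |H| = |K|`);
* `eisenstein_of_equal_moduli` — `|a| = |b| = |a + b|` forces `(a² + ab + b²)·b̄² = 0` (the cube-root-of-unity configuration,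
  excluded by `CubeRootObstruction` when `3 ∤ |A|`);
* `cube_reflect_of_homometric` — ONCE all three pairs are homometric at `ψ`, the flipped vertex equations give immediately
  `σ₁ = ψ(x₁−x₃)·σ̄₀`, `τ₁ = ψ(x₁−x₅)·τ̄₀`, `υ₁ = ψ(x₁−x₇)·ῡ₀` (multiply `E3` by `σ₁/σ̄₀` and use `σ₁σ̄₁ = σ₀σ̄₀` to recover `E1`);
* `cube_structure_of_homometric_charsums` — Finset form: homometry of the three pairs at every `ψ ≠ 0` together with
  `E1, E3, E5, E7` forces `S₁ = (x₁−x₃) − S₀`, `T₁ = (x₁−x₅) − T₀`, `U₁ = (x₁−x₇) − U₀`.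
The remaining step of the general theorem — homometry of all three pairs from the three dichotomies (at most one pair can fail;
a single failing pair is the Eisenstein configuration) — is written out on paper in the THEORY file and is the successor's item.
-/

namespace Summit.MatrixMultiplication.OmegaCensus

open Finset

section Core

open ComplexConjugate

/-- The `2 × 2` unit-equation mechanism with a free triple `(F,H,K)` and its conjugate triple `(G,Hc,Kc)`: either
`u₀v₀ = u₁v₁` (the pair is homometric) or `F G = H Hc` and `K Kc = F G`. [folklore] -/
theorem unit_pair_dichotomy (F H K G Hc Kc u₀ u₁ v₀ v₁ p₁ p₂ q₀ q₇ p₁' p₂' q₀' q₇' : ℂ)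
    (hp₁ : p₁ * p₁' = 1) (hp₂ : p₂ * p₂' = 1) (hq₀ : q₀ * q₀' = 1) (hq₇ : q₇ * q₇' = 1)
    (hu1 : F * u₀ + H * u₁ = -p₁) (hu2 : K * u₀ + F * u₁ = -p₂)
    (hu3 : G * u₀ + Kc * u₁ = -q₀) (hu4 : Hc * u₀ + G * u₁ = -q₇)
    (hv1 : G * v₀ + Hc * v₁ = -p₁') (hv2 : Kc * v₀ + G * v₁ = -p₂')
    (hv3 : F * v₀ + K * v₁ = -q₀') (hv4 : H * v₀ + F * v₁ = -q₇') :
    u₀ * v₀ = u₁ * v₁ ∨ (F * G = H * Hc ∧ K * Kc = F * G) := by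
  have hc : (F * G - H * Hc) * (u₀ * v₀ - u₁ * v₁) = 0 := by
    linear_combination (G * v₀ + Hc * v₁) * hu1 - p₁ * hv1 - (H * v₀ + F * v₁) * hu4 + q₇ * hv4 + hp₁ - hq₇
  have hd : (K * Kc - F * G) * (u₀ * v₀ - u₁ * v₁) = 0 := by
    linear_combination (Kc * v₀ + G * v₁) * hu2 - p₂ * hv2 - (F * v₀ + K * v₁) * hu3 + q₀ * hv3 + hp₂ - hq₀
  by_cases h : u₀ * v₀ = u₁ * v₁
  · exact Or.inl h
  · right
    have hne : u₀ * v₀ - u₁ * v₁ ≠ 0 := sub_ne_zero.2 h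
    exact ⟨sub_eq_zero.1 ((mul_eq_zero.1 hc).resolve_right hne),
      (sub_eq_zero.1 ((mul_eq_zero.1 hd).resolve_right hne))⟩

/-- `x · conj x = 0 ↔ x = 0`. [folklore] -/
theorem mul_conj_eq_zero_iff' (x : ℂ) : x * conj x = 0 ↔ x = 0 := by
  rw [Complex.mul_conj]; exact_mod_cast Complex.normSq_eq_zero

/-- If `a ā = b b̄ = (a+b)(ā+b̄)` then `(a² + ab + b²)·b̄² = 0` (so `a/b` is a primitive cube root of unity unless `b = 0`).
[folklore] -/
theorem eisenstein_of_equal_moduli {a b ca cb : ℂ} (h1 : a * ca = b * cb) (h2 : (a + b) * (ca + cb) = b * cb) :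
    (a ^ 2 + a * b + b ^ 2) * cb ^ 2 = 0 := by
  have e1 : a * ca - b * cb = 0 := by linear_combination h1
  have e2 : b * cb + a * cb + b * ca = 0 := by linear_combination h2 - h1
  linear_combination (a * cb) * e2 - (b * cb) * e1

/-- **Structure at one character from homometry.**  With `csᵢ = conj sᵢ` etc., homometry of the three pairs and the vertex
equations `E1` (of `(S,T,U)`), `E3, E5, E7` (vertex `000` of the `S`-, `T`-, `U`-flipped triples): `s₁ = p₁p₃'·cs₀`,
`t₁ = p₁p₅'·ct₀`, `u₁ = p₁p₇'·cu₀` (`pᵢpᵢ' = 1`). [folklore] -/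
theorem cube_reflect_of_homometric (s₀ s₁ t₀ t₁ u₀ u₁ cs₀ cs₁ ct₀ ct₁ cu₀ cu₁ p₁ p₃ p₅ p₇ p₃' p₅' p₇' : ℂ)
    (hcs₀ : cs₀ = conj s₀) (hcs₁ : cs₁ = conj s₁) (hct₀ : ct₀ = conj t₀) (hct₁ : ct₁ = conj t₁)
    (hcu₀ : cu₀ = conj u₀) (hcu₁ : cu₁ = conj u₁)
    (hp₃ : p₃ * p₃' = 1) (hp₅ : p₅ * p₅' = 1) (hp₇ : p₇ * p₇' = 1) (np₁ : p₁ ≠ 0)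
    (HS : s₀ * cs₀ = s₁ * cs₁) (HT : t₀ * ct₀ = t₁ * ct₁) (HU : u₀ * cu₀ = u₁ * cu₁)
    (E1 : s₁ * t₀ * u₀ + s₀ * t₁ * u₀ + s₀ * t₀ * u₁ = -p₁)
    (E3 : cs₀ * t₀ * u₀ + cs₁ * t₁ * u₀ + cs₁ * t₀ * u₁ = -p₃)
    (E5 : s₁ * ct₁ * u₀ + s₀ * ct₀ * u₀ + s₀ * ct₁ * u₁ = -p₅)
    (E7 : s₁ * t₀ * cu₁ + s₀ * t₁ * cu₁ + s₀ * t₀ * cu₀ = -p₇) :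
    s₁ = p₁ * p₃' * cs₀ ∧ t₁ = p₁ * p₅' * ct₀ ∧ u₁ = p₁ * p₇' * cu₀ := by
  -- no sum vanishes: if `s₀ = 0` then `s₁ = 0` by homometry and `E1` reads `0 = -p₁`
  have ns₀ : cs₀ ≠ 0 := by
    intro h0
    have hs0 : s₀ = 0 := by rw [hcs₀] at h0; simpa using h0
    have hs1 : s₁ = 0 := by
      have : s₁ * cs₁ = 0 := by rw [← HS, h0, mul_zero]
      rw [hcs₁] at this; exact (mul_conj_eq_zero_iff' s₁).1 this
    apply np₁; have := E1; rw [hs0, hs1] at this; linear_combination this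
  have nt₀ : ct₀ ≠ 0 := by
    intro h0
    have ht0 : t₀ = 0 := by rw [hct₀] at h0; simpa using h0
    have ht1 : t₁ = 0 := by
      have : t₁ * ct₁ = 0 := by rw [← HT, h0, mul_zero]
      rw [hct₁] at this; exact (mul_conj_eq_zero_iff' t₁).1 this
    apply np₁; have := E1; rw [ht0, ht1] at this; linear_combination this
  have nu₀ : cu₀ ≠ 0 := by
    intro h0
    have hu0 : u₀ = 0 := by rw [hcu₀] at h0; simpa using h0
    have hu1 : u₁ = 0 := by
      have : u₁ * cu₁ = 0 := by rw [← HU, h0, mul_zero]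
      rw [hcu₁] at this; exact (mul_conj_eq_zero_iff' u₁).1 this
    apply np₁; have := E1; rw [hu0, hu1] at this; linear_combination this
  refine ⟨?_, ?_, ?_⟩
  · -- `s₁·E3 = cs₀·E1` using `s₁cs₁ = s₀cs₀`; hence `-p₃ s₁ = -p₁ cs₀`
    have key : s₁ * p₃ = cs₀ * p₁ := by
      linear_combination s₁ * E3 - cs₀ * E1 + (t₁ * u₀ + t₀ * u₁) * HS
    have : s₁ * (p₃ * p₃') = cs₀ * p₁ * p₃' := by rw [← mul_assoc, key]
    rw [hp₃, mul_one] at this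
    linear_combination this
  · have key : t₁ * p₅ = ct₀ * p₁ := by
      linear_combination t₁ * E5 - ct₀ * E1 + (s₁ * u₀ + s₀ * u₁) * HT
    have : t₁ * (p₅ * p₅') = ct₀ * p₁ * p₅' := by rw [← mul_assoc, key]
    rw [hp₅, mul_one] at this
    linear_combination this
  · have key : u₁ * p₇ = cu₀ * p₁ := by
      linear_combination u₁ * E7 - cu₀ * E1 + (s₁ * t₀ + s₀ * t₁) * HU
    have : u₁ * (p₇ * p₇') = cu₀ * p₁ * p₇' := by rw [← mul_assoc, key]
    rw [hp₇, mul_one] at this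
    linear_combination this

end Core

section Finsets

variable {A : Type*} [AddCommGroup A] [Fintype A] [DecidableEq A]

/-- **Cube structure from homometry (Finset form).**  If at every non-trivial character the three pairs of coset parts are
homometric (`|σ₀| = |σ₁|`, `|τ₀| = |τ₁|`, `|υ₀| = |υ₁|`), `|S₀| = |S₁|`, `|T₀| = |T₁|`, `|U₀| = |U₁|`, and the vertex-`000`
equations of the triple and of its three flips hold with missed points `x₁, x₃, x₅, x₇`, then
`S₁ = (x₁−x₃) − S₀`, `T₁ = (x₁−x₅) − T₀`, `U₁ = (x₁−x₇) − U₀`. [folklore] -/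
theorem cube_structure_of_homometric_charsums {S₀ S₁ T₀ T₁ U₀ U₁ : Finset A} {x₁ x₃ x₅ x₇ : A}
    (hS : S₀.card = S₁.card) (hT : T₀.card = T₁.card) (hU : U₀.card = U₁.card)
    (HS : ∀ ψ : AddChar A ℂ, ψ ≠ 0 → (∑ a ∈ S₀, ψ a) * (∑ a ∈ S₀, ψ (-a)) = (∑ a ∈ S₁, ψ a) * (∑ a ∈ S₁, ψ (-a)))
    (HT : ∀ ψ : AddChar A ℂ, ψ ≠ 0 → (∑ a ∈ T₀, ψ a) * (∑ a ∈ T₀, ψ (-a)) = (∑ a ∈ T₁, ψ a) * (∑ a ∈ T₁, ψ (-a)))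
    (HU : ∀ ψ : AddChar A ℂ, ψ ≠ 0 → (∑ a ∈ U₀, ψ a) * (∑ a ∈ U₀, ψ (-a)) = (∑ a ∈ U₁, ψ a) * (∑ a ∈ U₁, ψ (-a)))
    (E1 : ∀ ψ : AddChar A ℂ, ψ ≠ 0 →
      (∑ a ∈ S₁, ψ a) * (∑ a ∈ T₀, ψ a) * (∑ a ∈ U₀, ψ a) + (∑ a ∈ S₀, ψ a) * (∑ a ∈ T₁, ψ a) * (∑ a ∈ U₀, ψ a) +
        (∑ a ∈ S₀, ψ a) * (∑ a ∈ T₀, ψ a) * (∑ a ∈ U₁, ψ a) = -ψ x₁)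
    (E3 : ∀ ψ : AddChar A ℂ, ψ ≠ 0 →
      (∑ a ∈ S₀, ψ (-a)) * (∑ a ∈ T₀, ψ a) * (∑ a ∈ U₀, ψ a) + (∑ a ∈ S₁, ψ (-a)) * (∑ a ∈ T₁, ψ a) * (∑ a ∈ U₀, ψ a) +
        (∑ a ∈ S₁, ψ (-a)) * (∑ a ∈ T₀, ψ a) * (∑ a ∈ U₁, ψ a) = -ψ x₃)
    (E5 : ∀ ψ : AddChar A ℂ, ψ ≠ 0 →
      (∑ a ∈ S₁, ψ a) * (∑ a ∈ T₁, ψ (-a)) * (∑ a ∈ U₀, ψ a) + (∑ a ∈ S₀, ψ a) * (∑ a ∈ T₀, ψ (-a)) * (∑ a ∈ U₀, ψ a) +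
        (∑ a ∈ S₀, ψ a) * (∑ a ∈ T₁, ψ (-a)) * (∑ a ∈ U₁, ψ a) = -ψ x₅)
    (E7 : ∀ ψ : AddChar A ℂ, ψ ≠ 0 →
      (∑ a ∈ S₁, ψ a) * (∑ a ∈ T₀, ψ a) * (∑ a ∈ U₁, ψ (-a)) + (∑ a ∈ S₀, ψ a) * (∑ a ∈ T₁, ψ a) * (∑ a ∈ U₁, ψ (-a)) +
        (∑ a ∈ S₀, ψ a) * (∑ a ∈ T₀, ψ a) * (∑ a ∈ U₀, ψ (-a)) = -ψ x₇) :
    S₁ = S₀.image (fun b => (x₁ - x₃) - b) ∧ T₁ = T₀.image (fun b => (x₁ - x₅) - b) ∧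
      U₁ = U₀.image (fun b => (x₁ - x₇) - b) := by
  have main : ∀ ψ : AddChar A ℂ, ψ ≠ 0 →
      (∑ a ∈ S₁, ψ a) = ψ x₁ * ψ (-x₃) * (∑ a ∈ S₀, ψ (-a)) ∧
        (∑ a ∈ T₁, ψ a) = ψ x₁ * ψ (-x₅) * (∑ a ∈ T₀, ψ (-a)) ∧
        (∑ a ∈ U₁, ψ a) = ψ x₁ * ψ (-x₇) * (∑ a ∈ U₀, ψ (-a)) := by
    intro ψ hψ
    have cj : ∀ X : Finset A, (∑ a ∈ X, ψ (-a)) = (starRingEnd ℂ) (∑ a ∈ X, ψ a) := fun X => (conj_charsum' ψ X).symm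
    have un : ∀ x : A, ψ x * ψ (-x) = 1 := fun x => by
      rw [← AddChar.map_add_eq_mul, add_neg_cancel, AddChar.map_zero_eq_one]
    have np : ψ x₁ ≠ 0 := fun h => by have := un x₁; rw [h, zero_mul] at this; exact zero_ne_one this
    exact cube_reflect_of_homometric (∑ a ∈ S₀, ψ a) (∑ a ∈ S₁, ψ a) (∑ a ∈ T₀, ψ a) (∑ a ∈ T₁, ψ a)
      (∑ a ∈ U₀, ψ a) (∑ a ∈ U₁, ψ a) (∑ a ∈ S₀, ψ (-a)) (∑ a ∈ S₁, ψ (-a)) (∑ a ∈ T₀, ψ (-a)) (∑ a ∈ T₁, ψ (-a))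
      (∑ a ∈ U₀, ψ (-a)) (∑ a ∈ U₁, ψ (-a)) (ψ x₁) (ψ x₃) (ψ x₅) (ψ x₇) (ψ (-x₃)) (ψ (-x₅)) (ψ (-x₇))
      (cj S₀) (cj S₁) (cj T₀) (cj T₁) (cj U₀) (cj U₁) (un x₃) (un x₅) (un x₇) np
      (HS ψ hψ) (HT ψ hψ) (HU ψ hψ) (E1 ψ hψ) (E3 ψ hψ) (E5 ψ hψ) (E7 ψ hψ)
  refine ⟨?_, ?_, ?_⟩
  · refine finset_eq_of_charsum_eq fun ψ => ?_
    rw [charsum_image_sub]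
    by_cases hψ : ψ = 0
    · subst hψ; simp only [AddChar.zero_apply, sum_const, nsmul_eq_mul, mul_one, one_mul]; exact_mod_cast hS.symm
    · rw [(main ψ hψ).1, AddChar.map_sub_eq_div, div_eq_mul_inv, ← AddChar.map_neg_eq_inv]
  · refine finset_eq_of_charsum_eq fun ψ => ?_
    rw [charsum_image_sub]
    by_cases hψ : ψ = 0
    · subst hψ; simp only [AddChar.zero_apply, sum_const, nsmul_eq_mul, mul_one, one_mul]; exact_mod_cast hT.symm
    · rw [(main ψ hψ).2.1, AddChar.map_sub_eq_div, div_eq_mul_inv, ← AddChar.map_neg_eq_inv]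
  · refine finset_eq_of_charsum_eq fun ψ => ?_
    rw [charsum_image_sub]
    by_cases hψ : ψ = 0
    · subst hψ; simp only [AddChar.zero_apply, sum_const, nsmul_eq_mul, mul_one, one_mul]; exact_mod_cast hU.symm
    · rw [(main ψ hψ).2.2, AddChar.map_sub_eq_div, div_eq_mul_inv, ← AddChar.map_neg_eq_inv]

end Finsets

end Summit.MatrixMultiplication.OmegaCensus
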